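import Literature.IUT.HodgeTheaters.TemperedCoveringsProp24iiObservationRF
import Literature.IUT.HodgeTheaters.StableCurveTemperedDataOfSpecialFibrePrintedLaws
import Literature.IUT.HodgeTheaters.StableCurveTemperedDataOfSpecialFibreTowerPiData
import Literature.IUT.HodgeTheaters.TemperedCoveringsNodNonAt
import Literature.AnabelianGeometry.SemiGraphs.TemperedGaloisDomination
import HarnessLib

/-!
# [IUTchI] Prop. 2.4 (i)(ii)(iii) and Cor. 2.5 at the genuine 𝔛-datum — ONE CALL with every law a PRINTED
# citation keyed on the tree's typed predicates

Mochizuki, *Inter-universal Teichmüller theory I*, kurims manuscript (May 2020), §2, Prop. 2.4 and its proof pp. 50–51,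
Cor. 2.5 p. 51 [cite: Mochizuki2012, Prop 2.4 pp.50-51] (D-0012 claim key; nothing of the series is asserted here),
over Mochizuki, *Semi-graphs of anabelioids*, Publ. RIMS **42** (2006), Thm. 3.7 (iii) p. 41, Thm. 5.4 (i) p. 66,
Ex. 3.10 / 5.6 pp. 44–45 / 67 [cite: MochizukiSemiAnbd2006, Thm 3.7(iii) p.41], and Hoshi–Mochizuki [NodNon] Lem. 1.9 (ii)
(typed as abc-iut-L3's predicate `PSCDatum.VerticialIntersectionNear`, FACT-LIST F-2540)
[cite: HoshiMochizukiNodNon2011, Lem 1.9 (ii) p.291].  Pages: [IUTchI] = kurims preprint render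
IUTchI-kurims-url-690e7b3c6199; [SemiAnbd] = kurims render SemiAnbd-kurims-url-f33ace170ff4 (lit/SOURCES.md §0/§11).

PROOF-ONLY assembly (abc-iut-L5-t11; no definitions, no new `Prop` fact).  It gathers this lineage's printed-form
reductions into ONE closed term at the genuine 𝔛-datum `StableCurveTemperedData.ofSpecialFibre X d S …` over the origin
record `P : SpecialFibreTower.PiData X d S T`:
* (i), Prop. 2.1 at every level graph `𝔾_{J_i}`: `prop21_levelGraph_byName_at` / `prop21Levels_ofPiData_byName_at` —
  [SemiAnbd] Thm 3.7 (iii) AT the finite level fibre is the THEOREM `compactInVerticialAt_of_finiteGraph'` (from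
  `P.finite`), Galois domination is `galoisDomination_of_prop36 (T.hyp i)`, the completion law is
  `ofChart_isProfiniteCompletion`, and (A3) is the FROZEN predicate F-2540 `PSCDatum.VerticialIntersectionNear` BY NAME
  for a `PSCDatum` on `Π̂_{𝔾_{J_i}}` whose verticial subgroups are the images of a verticial family of the chart
  (abc-iut-L5-t11's `prop21_byName_at`, as abc-iut-f-192 does at the base graph);
* (i), the remaining laws: `hTF` ([Config] Rmk 1.2.2 printed form), `hab` (pro-`Σ` abelianizations along `adm_i`),
  `hadm` ("the admissible kernels shrink to `1`", giving (INV) by abc-iut-f-193's `detectsTempered_ofSpecialFibre_of_admKer_nhds_one`);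
* (ii): "this observation" from abc-iut-L3's TYPED [SemiAnbd] Thm 5.4 (i) `ArithMaximalCompactStatementI` for the
  canonical augmentation of every level quotient (`hI`), the residual-finiteness reading (RF)_j (`hRF`) and (A3-arith)_j
  (`hA3ar`) — `prop24ii_ofPiData_of_arithStatementI_canonical_of_RF`;
* (iii) and Cor. 2.5: `prop24iii_ofSpecialFibre`, `cor25_ofSpecialFibre` (abc-iut-L5-t11 gen 6) from (i), (ii) and a cusp.
Result `prop24_cor25_ofPiData_byName`.  LAW list: hTF · hNN_i (F-2540) · hab · hadm · hI_j · hRF_j · hA3ar_j; DATA and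
identification side conditions: `P`, a cusp `x`, per level `i` a `PSCDatum` `G i` with `σ`, `Λv`, `hvert`, `hΛv`, node
end-point data `hends/h₁/h₂/hloop`, and per level `j` a `DecompositionData` with node/branch data.  Nothing of [IUTchI]
is assumed.  CONDITIONAL, as labelled; typed ≠ discharged for the laws; `P` is origin data inhabited at model towers
only; nothing here asserts that abc is proved or refuted, and nothing here bears on [IUTchIII] Cor. 3.12.
-/

noncomputable section

namespace Literature.IUT.HodgeTheaters

open _root_.Topology
open scoped Pointwise
open Literature.AnabelianGeometry.SemiGraphs Literature.AnabelianGeometry.SemiGraphs.ProfiniteSemiGraph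

namespace StableCurveTemperedData

namespace OfSpecialFibre

variable {p : ℕ} [Fact p.Prime] (X : TemperedCurve p) (d : X.GroupLevelData)
  (T : SpecialFibreTower X.DeltaTemp)
  (Sigma SigmaHat : Set ℕ) (hsub : Sigma ⊆ SigmaHat) (hne : Set.Nonempty Sigma)
  (hprime : ∀ q ∈ SigmaHat, q.Prime)

/-- **Prop. 2.1 for the level graph `𝔾_{J_i}`, EVERY printed input BY NAME** — (A3) := the frozen predicate F-2540
`PSCDatum.VerticialIntersectionNear` ([NodNon] Lem 1.9 (ii)) for a `PSCDatum` `G` on `Π̂_{𝔾_{J_i}}` whose verticial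
subgroups are the images of a verticial family `Λv` of the level chart; [SemiAnbd] Thm 3.7 (iii) AT `𝒢^c_i` (`hCV`),
Galois domination (`galoisDomination_of_prop36 (T.hyp i)`) and the completion law (`ofChart_isProfiniteCompletion`)
are kernel theorems (abc-iut-L5-t11's `prop21_byName_at` at `D := levelGraph … i`, `c := T.chart i`, `e := refl`).
([IUTchI] Prop 2.1 p.45) [claim: Mochizuki2012, status: disputed] -/
theorem prop21_levelGraph_byName_at (i : ℕ) (hCV : CompactInVerticialAt (T.Gc i))
    (G : PSCDatum (levelGraph X T Sigma SigmaHat hsub hne hprime i).Hat) (hNN : G.VerticialIntersectionNear)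
    (σ : (T.Gc i).graph.Vertex ≃ G.graph.V) (Λv : G.graph.V → Subgroup (T.chart i).G)
    (hvert : ∀ v : (T.Gc i).graph.Vertex, Λv (σ v) ∈ verticialSubgroups (T.chart i) v)
    (hΛv : ∀ v, (Λv v).map (levelGraph X T Sigma SigmaHat hsub hne hprime i).ι = G.vertGp v)
    (src tgt : G.graph.N → G.graph.V) (c₁ c₂ : G.graph.N → (T.chart i).G)
    (hends : ∀ e, G.graph.nodeEnds e = s(src e, tgt e))
    (h₁ : ∀ e, G.nodeGp e ≤ MulAut.conj ((levelGraph X T Sigma SigmaHat hsub hne hprime i).ι (c₁ e)) • G.vertGp (src e))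
    (h₂ : ∀ e, G.nodeGp e ≤ MulAut.conj ((levelGraph X T Sigma SigmaHat hsub hne hprime i).ι (c₂ e)) • G.vertGp (tgt e))
    (hloop : ∀ e, src e = tgt e → (c₁ e)⁻¹ * c₂ e ∉ Λv (src e)) :
    (levelGraph X T Sigma SigmaHat hsub hne hprime i).ProfiniteConjugatesOfCompactSubgroups :=
  (levelGraph X T Sigma SigmaHat hsub hne hprime i).prop21_byName_at (T.chart i) (ContinuousMulEquiv.refl _)
    (T.hyp i) hCV
    (TemperedGraphGroupData.ofChart_isProfiniteCompletion (T.Gc i) (T.hyp i).toProp36Hypotheses (T.chart i)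
      Sigma SigmaHat hsub hne hprime ⊤ ⊤ le_top)
    (galoisDomination_of_prop36 (T.hyp i).toProp36Hypotheses) G hNN σ Λv
    (fun v => by
      convert hvert v using 1
      ext x
      constructor
      · rintro ⟨y, hy, rfl⟩
        exact hy
      · intro hx
        exact ⟨x, hx, rfl⟩)
    hΛv src tgt c₁ c₂ hends h₁ h₂ hloop

variable (S : SpecialFibreData (X.toTemperedArithmeticGroup d)) (h36 : S.Gc.Prop36Hypotheses)
  (hp : p ∉ Sigma) (TpH : Subgroup S.chart.G)
  (HatH : Subgroup (TemperedGraphGroupData.exists_completion_of_prop36 S.Gc h36 S.chart).choose)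
  (hle : TpH.map (TemperedGraphGroupData.exists_completion_of_prop36 S.Gc h36
    S.chart).choose_spec.choose.toMonoidHom ≤ HatH)
  (cuspMeetsH : {x : X.Pt // X.IsCusp x} → Prop)

/-- **(L1) `Prop21Levels` of the genuine tower over `P`, every printed input BY NAME**: at every level the Thm 3.7 (iii)
input is the THEOREM `compactInVerticialAt_of_finiteGraph'` (finite fibres, `P.finite`), and (A3) is F-2540
`VerticialIntersectionNear` of a per-level `PSCDatum`. ([IUTchI] Prop 2.4(i) p.50) [claim: Mochizuki2012, status: disputed] -/
theorem prop21Levels_ofPiData_byName_at (P : SpecialFibreTower.PiData X d S T)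
    (G : ∀ i, PSCDatum (levelGraph X T Sigma SigmaHat hsub hne hprime i).Hat)
    (hNN : ∀ i, (G i).VerticialIntersectionNear)
    (σ : ∀ i, (T.Gc i).graph.Vertex ≃ (G i).graph.V) (Λv : ∀ i, (G i).graph.V → Subgroup (T.chart i).G)
    (hvert : ∀ i (v : (T.Gc i).graph.Vertex), Λv i (σ i v) ∈ verticialSubgroups (T.chart i) v)
    (hΛv : ∀ i v, (Λv i v).map (levelGraph X T Sigma SigmaHat hsub hne hprime i).ι = (G i).vertGp v)
    (src tgt : ∀ i, (G i).graph.N → (G i).graph.V) (c₁ c₂ : ∀ i, (G i).graph.N → (T.chart i).G)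
    (hends : ∀ i e, (G i).graph.nodeEnds e = s(src i e, tgt i e))
    (h₁ : ∀ i e, (G i).nodeGp e ≤
      MulAut.conj ((levelGraph X T Sigma SigmaHat hsub hne hprime i).ι (c₁ i e)) • (G i).vertGp (src i e))
    (h₂ : ∀ i e, (G i).nodeGp e ≤
      MulAut.conj ((levelGraph X T Sigma SigmaHat hsub hne hprime i).ι (c₂ i e)) • (G i).vertGp (tgt i e))
    (hloop : ∀ i e, src i e = tgt i e → (c₁ i e)⁻¹ * c₂ i e ∉ Λv i (src i e)) :
    (towerOfSpecialFibreTower X d T Sigma SigmaHat hsub hne hprime S h36 hp TpH HatH hle cuspMeetsH).Prop21Levels :=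
  fun i => prop21_levelGraph_byName_at X T Sigma SigmaHat hsub hne hprime i
    (compactInVerticialAt_levels_of_finiteLevels X d T S P.finite i) (G i) (hNN i) (σ i) (Λv i) (hvert i) (hΛv i)
    (src i) (tgt i) (c₁ i) (c₂ i) (hends i) (h₁ i) (h₂ i) (hloop i)

/-- **[IUTchI] Prop. 2.4 (i)(ii)(iii) ∧ Cor. 2.5 AS TYPED at the genuine 𝔛-datum over `P`, ONE CALL, every law a
printed citation on a typed predicate of the tree.**  (i): (L1) by `prop21Levels_ofPiData_byName_at` ((A3) := F-2540
`VerticialIntersectionNear`), [Config] Rmk 1.2.2 in printed form (`hTF`), the pro-`Σ` abelianization law along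
`adm_i` (`hab`), (INV) from `hadm` (abc-iut-f-193); (ii): "this observation" from abc-iut-L3's typed [SemiAnbd]
Thm 5.4 (i) for the canonical augmentation (`hI`), (RF)_j (`hRF`), (A3-arith)_j (`hA3ar`); (iii) and Cor. 2.5 from
(i), (ii) and a cusp `x`. ([IUTchI] Prop 2.4, Cor 2.5 pp.50-51) [claim: Mochizuki2012, status: disputed] -/
theorem prop24_cor25_ofPiData_byName (P : SpecialFibreTower.PiData X d S T) (x : {x : X.Pt // X.IsCusp x})
    -- (i): [Config] Rmk 1.2.2, printed form on `X.DeltaHat`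
    (hTF : ∀ H : Subgroup X.DeltaHat, IsOpen (H : Set X.DeltaHat) →
      ∀ (h : H) (n : ℕ), n ≠ 0 →
        SigmaCharDetects Set.univ H h → SigmaCharDetects Set.univ H (h ^ n))
    -- (i): per-level PSC data with (A3) := F-2540 BY NAME and the identification side conditions
    (G : ∀ i, PSCDatum (levelGraph X T Sigma SigmaHat hsub hne hprime i).Hat)
    (hNN : ∀ i, (G i).VerticialIntersectionNear)
    (σ : ∀ i, (T.Gc i).graph.Vertex ≃ (G i).graph.V) (Λv : ∀ i, (G i).graph.V → Subgroup (T.chart i).G)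
    (hvert : ∀ i (v : (T.Gc i).graph.Vertex), Λv i (σ i v) ∈ verticialSubgroups (T.chart i) v)
    (hΛv : ∀ i v, (Λv i v).map (levelGraph X T Sigma SigmaHat hsub hne hprime i).ι = (G i).vertGp v)
    (src tgt : ∀ i, (G i).graph.N → (G i).graph.V) (c₁ c₂ : ∀ i, (G i).graph.N → (T.chart i).G)
    (hends : ∀ i e, (G i).graph.nodeEnds e = s(src i e, tgt i e))
    (h₁ : ∀ i e, (G i).nodeGp e ≤
      MulAut.conj ((levelGraph X T Sigma SigmaHat hsub hne hprime i).ι (c₁ i e)) • (G i).vertGp (src i e))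
    (h₂ : ∀ i e, (G i).nodeGp e ≤
      MulAut.conj ((levelGraph X T Sigma SigmaHat hsub hne hprime i).ι (c₂ i e)) • (G i).vertGp (tgt i e))
    (hloop : ∀ i e, src i e = tgt i e → (c₁ i e)⁻¹ * c₂ i e ∉ Λv i (src i e))
    -- (i): the pro-`Σ` abelianization law along the admissible quotients
    (hab : ∀ (i : ℕ) (A : Type) [CommGroup A] [Finite A] (χ : T.N i →* A),
      IsOpen ((χ.ker : Subgroup (T.N i)) : Set (T.N i)) →
      (∀ q : ℕ, q.Prime → q ∣ Nat.card A → q ∈ Sigma) → (T.adm i).toMonoidHom.ker ≤ χ.ker)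
    -- (i)(ii): the admissible kernels shrink to `1`
    (hadm : ∀ U ∈ 𝓝 (1 : ↥X.DeltaTemp), ∃ j, ((T.admKer j : Subgroup ↥X.DeltaTemp) : Set ↥X.DeltaTemp) ⊆ U)
    -- (ii): per-level arithmetic decomposition data, L3's typed Thm 5.4 (i), (RF)_j, node data, (A3-arith)_j
    {V B : ℕ → Type*}
    (Dd : ∀ j, DecompositionData ((qTowerOfSpecialFibreTower X T d S h36 Sigma SigmaHat hsub hne hprime hp TpH HatH hle cuspMeetsH P.admKer_normal_pi).Q j).Tp (V j) (B j))
    (hI : ∀ (j : ℕ) (a : ((qTowerOfSpecialFibreTower X T d S h36 Sigma SigmaHat hsub hne hprime hp TpH HatH hle cuspMeetsH P.admKer_normal_pi).Q j).Tp →* X.GK),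
      a.comp ((qTowerOfSpecialFibreTower X T d S h36 Sigma SigmaHat hsub hne hprime hp TpH HatH hle cuspMeetsH P.admKer_normal_pi).qtp j) = X.augGK.toMonoidHom →
        ArithMaximalCompactStatementI (Dd j) a)
    (hRF : ∀ (j : ℕ), ∀ U ∈ 𝓝 (1 : ((qTowerOfSpecialFibreTower X T d S h36 Sigma SigmaHat hsub hne hprime hp TpH HatH hle
        cuspMeetsH P.admKer_normal_pi).Q j).Tp),
      ∃ N : OpenNormalSubgroup ((qTowerOfSpecialFibreTower X T d S h36 Sigma SigmaHat hsub hne hprime hp TpH HatH hle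
          cuspMeetsH P.admKer_normal_pi).Q j).Tp,
        (N : Set _) ⊆ U ∧
          ((N.toSubgroup.map ((qTowerOfSpecialFibreTower X T d S h36 Sigma SigmaHat hsub hne hprime hp TpH HatH hle
              cuspMeetsH P.admKer_normal_pi).Q j).ι).topologicalClosure).comap
            ((qTowerOfSpecialFibreTower X T d S h36 Sigma SigmaHat hsub hne hprime hp TpH HatH hle
              cuspMeetsH P.admKer_normal_pi).Q j).ι ≤ N.toSubgroup)
    {EA : ℕ → Type*} (srcA tgtA : ∀ j, EA j → V j)
    (c₁A c₂A : ∀ j, EA j → ((qTowerOfSpecialFibreTower X T d S h36 Sigma SigmaHat hsub hne hprime hp TpH HatH hle cuspMeetsH P.admKer_normal_pi).Q j).Tp)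
    (hA3ar : ∀ (j : ℕ) (Λ : Subgroup X.PiTemp), IsCompact (Λ : Set X.PiTemp) → Λ ≠ ⊥ →
      IsOpen (Λ.map X.augGK.toMonoidHom : Set X.GK) →
      ∀ (v w : V j) (g h γ : ((qTowerOfSpecialFibreTower X T d S h36 Sigma SigmaHat hsub hne hprime hp TpH HatH hle cuspMeetsH P.admKer_normal_pi).Q j).Hat),
        MulAut.conj γ • Λ.map (((qTowerOfSpecialFibreTower X T d S h36 Sigma SigmaHat hsub hne hprime hp TpH HatH hle cuspMeetsH P.admKer_normal_pi).qhat j).comp X.toHat.toMonoidHom) ≤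
            MulAut.conj g • ((Dd j).vertGp v).map ((qTowerOfSpecialFibreTower X T d S h36 Sigma SigmaHat hsub hne hprime hp TpH HatH hle cuspMeetsH P.admKer_normal_pi).Q j).ι →
        MulAut.conj γ • Λ.map (((qTowerOfSpecialFibreTower X T d S h36 Sigma SigmaHat hsub hne hprime hp TpH HatH hle cuspMeetsH P.admKer_normal_pi).qhat j).comp X.toHat.toMonoidHom) ≤
            MulAut.conj h • ((Dd j).vertGp w).map ((qTowerOfSpecialFibreTower X T d S h36 Sigma SigmaHat hsub hne hprime hp TpH HatH hle cuspMeetsH P.admKer_normal_pi).Q j).ι →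
          (v = w ∧ g⁻¹ * h ∈ ((Dd j).vertGp v).map ((qTowerOfSpecialFibreTower X T d S h36 Sigma SigmaHat hsub hne hprime hp TpH HatH hle cuspMeetsH P.admKer_normal_pi).Q j).ι) ∨
          (∃ (e : EA j) (k : ((qTowerOfSpecialFibreTower X T d S h36 Sigma SigmaHat hsub hne hprime hp TpH HatH hle cuspMeetsH P.admKer_normal_pi).Q j).Hat),
            ∃ p ∈ ((Dd j).vertGp (srcA j e)).map ((qTowerOfSpecialFibreTower X T d S h36 Sigma SigmaHat hsub hne hprime hp TpH HatH hle cuspMeetsH P.admKer_normal_pi).Q j).ι,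
            ∃ q ∈ ((Dd j).vertGp (tgtA j e)).map ((qTowerOfSpecialFibreTower X T d S h36 Sigma SigmaHat hsub hne hprime hp TpH HatH hle cuspMeetsH P.admKer_normal_pi).Q j).ι,
            (srcA j e = v ∧ tgtA j e = w ∧
                g = k * ((qTowerOfSpecialFibreTower X T d S h36 Sigma SigmaHat hsub hne hprime hp TpH HatH hle cuspMeetsH P.admKer_normal_pi).Q j).ι (c₁A j e) * p ∧
                h = k * ((qTowerOfSpecialFibreTower X T d S h36 Sigma SigmaHat hsub hne hprime hp TpH HatH hle cuspMeetsH P.admKer_normal_pi).Q j).ι (c₂A j e) * q) ∨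
            (srcA j e = w ∧ tgtA j e = v ∧
                h = k * ((qTowerOfSpecialFibreTower X T d S h36 Sigma SigmaHat hsub hne hprime hp TpH HatH hle cuspMeetsH P.admKer_normal_pi).Q j).ι (c₁A j e) * p ∧
                g = k * ((qTowerOfSpecialFibreTower X T d S h36 Sigma SigmaHat hsub hne hprime hp TpH HatH hle cuspMeetsH P.admKer_normal_pi).Q j).ι (c₂A j e) * q)) ∨
          (∃ (u : V j) (f : ((qTowerOfSpecialFibreTower X T d S h36 Sigma SigmaHat hsub hne hprime hp TpH HatH hle cuspMeetsH P.admKer_normal_pi).Q j).Hat),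
            (∃ (e : EA j) (k : ((qTowerOfSpecialFibreTower X T d S h36 Sigma SigmaHat hsub hne hprime hp TpH HatH hle cuspMeetsH P.admKer_normal_pi).Q j).Hat),
              ∃ p ∈ ((Dd j).vertGp (srcA j e)).map ((qTowerOfSpecialFibreTower X T d S h36 Sigma SigmaHat hsub hne hprime hp TpH HatH hle cuspMeetsH P.admKer_normal_pi).Q j).ι,
              ∃ q ∈ ((Dd j).vertGp (tgtA j e)).map ((qTowerOfSpecialFibreTower X T d S h36 Sigma SigmaHat hsub hne hprime hp TpH HatH hle cuspMeetsH P.admKer_normal_pi).Q j).ι,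
              (srcA j e = v ∧ tgtA j e = u ∧
                  g = k * ((qTowerOfSpecialFibreTower X T d S h36 Sigma SigmaHat hsub hne hprime hp TpH HatH hle cuspMeetsH P.admKer_normal_pi).Q j).ι (c₁A j e) * p ∧
                  f = k * ((qTowerOfSpecialFibreTower X T d S h36 Sigma SigmaHat hsub hne hprime hp TpH HatH hle cuspMeetsH P.admKer_normal_pi).Q j).ι (c₂A j e) * q) ∨
              (srcA j e = u ∧ tgtA j e = v ∧
                  f = k * ((qTowerOfSpecialFibreTower X T d S h36 Sigma SigmaHat hsub hne hprime hp TpH HatH hle cuspMeetsH P.admKer_normal_pi).Q j).ι (c₁A j e) * p ∧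
                  g = k * ((qTowerOfSpecialFibreTower X T d S h36 Sigma SigmaHat hsub hne hprime hp TpH HatH hle cuspMeetsH P.admKer_normal_pi).Q j).ι (c₂A j e) * q)) ∧
            (∃ (e : EA j) (k : ((qTowerOfSpecialFibreTower X T d S h36 Sigma SigmaHat hsub hne hprime hp TpH HatH hle cuspMeetsH P.admKer_normal_pi).Q j).Hat),
              ∃ p ∈ ((Dd j).vertGp (srcA j e)).map ((qTowerOfSpecialFibreTower X T d S h36 Sigma SigmaHat hsub hne hprime hp TpH HatH hle cuspMeetsH P.admKer_normal_pi).Q j).ι,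
              ∃ q ∈ ((Dd j).vertGp (tgtA j e)).map ((qTowerOfSpecialFibreTower X T d S h36 Sigma SigmaHat hsub hne hprime hp TpH HatH hle cuspMeetsH P.admKer_normal_pi).Q j).ι,
              (srcA j e = u ∧ tgtA j e = w ∧
                  f = k * ((qTowerOfSpecialFibreTower X T d S h36 Sigma SigmaHat hsub hne hprime hp TpH HatH hle cuspMeetsH P.admKer_normal_pi).Q j).ι (c₁A j e) * p ∧
                  h = k * ((qTowerOfSpecialFibreTower X T d S h36 Sigma SigmaHat hsub hne hprime hp TpH HatH hle cuspMeetsH P.admKer_normal_pi).Q j).ι (c₂A j e) * q) ∨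
              (srcA j e = w ∧ tgtA j e = u ∧
                  h = k * ((qTowerOfSpecialFibreTower X T d S h36 Sigma SigmaHat hsub hne hprime hp TpH HatH hle cuspMeetsH P.admKer_normal_pi).Q j).ι (c₁A j e) * p ∧
                  f = k * ((qTowerOfSpecialFibreTower X T d S h36 Sigma SigmaHat hsub hne hprime hp TpH HatH hle cuspMeetsH P.admKer_normal_pi).Q j).ι (c₂A j e) * q)))) :
    ((ofSpecialFibre X d S h36 Sigma SigmaHat hsub hne hprime hp TpH HatH hle cuspMeetsH).Prop24i ∧
      (ofSpecialFibre X d S h36 Sigma SigmaHat hsub hne hprime hp TpH HatH hle cuspMeetsH).Prop24ii ∧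
      (ofSpecialFibre X d S h36 Sigma SigmaHat hsub hne hprime hp TpH HatH hle cuspMeetsH).Prop24iii) ∧
    ((ofSpecialFibre X d S h36 Sigma SigmaHat hsub hne hprime hp TpH HatH hle cuspMeetsH).Cor25Decomposition ∧
      (ofSpecialFibre X d S h36 Sigma SigmaHat hsub hne hprime hp TpH HatH hle cuspMeetsH).Cor25Inertia) := by
  haveI : Nonempty X.Pt := ⟨x.1⟩
  haveI : Nonempty {x : X.Pt // X.IsCusp x} := ⟨x⟩
  -- (i)
  have h24i : (ofSpecialFibre X d S h36 Sigma SigmaHat hsub hne hprime hp TpH HatH hle cuspMeetsH).Prop24i :=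
    prop24i_ofSpecialFibre_of_tower X d T Sigma SigmaHat hsub hne hprime S h36 hp TpH HatH hle cuspMeetsH P.N_cofinal
      (stronglyTorsionFreeSigma_ofSpecialFibre_of_torsionFreeAb X d Sigma SigmaHat hsub hne hprime S h36 hp TpH HatH
        hle cuspMeetsH hTF)
      (prop21Levels_ofPiData_byName_at X d T Sigma SigmaHat hsub hne hprime S h36 hp TpH HatH hle cuspMeetsH P G hNN σ
        Λv hvert hΛv src tgt c₁ c₂ hends h₁ h₂ hloop)
      (specializationAb_ofSpecialFibre_of_characters X d T Sigma SigmaHat hsub hne hprime S h36 hp TpH HatH hle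
        cuspMeetsH hab)
      (detectsTempered_ofSpecialFibre_of_admKer_nhds_one X d T Sigma SigmaHat hsub hne hprime S h36 hp TpH HatH hle
        cuspMeetsH P.N_cofinal hadm)
  -- (ii)
  have h24ii : (ofSpecialFibre X d S h36 Sigma SigmaHat hsub hne hprime hp TpH HatH hle cuspMeetsH).Prop24ii :=
    prop24ii_ofPiData_of_arithStatementI_canonical_of_RF X T d S h36 Sigma SigmaHat hsub hne hprime hp TpH HatH hle
      cuspMeetsH P hadm Dd hI hRF srcA tgtA c₁A c₂A hA3ar
  exact ⟨⟨h24i, h24ii,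
      prop24iii_ofSpecialFibre X d S h36 Sigma SigmaHat hsub hne hprime hp TpH HatH hle cuspMeetsH x h24i⟩,
    cor25_ofSpecialFibre X d S h36 Sigma SigmaHat hsub hne hprime hp TpH HatH hle cuspMeetsH h24i h24ii⟩

end OfSpecialFibre

end StableCurveTemperedData

end Literature.IUT.HodgeTheaters

end
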